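import Summits.CriticalPhenomena.SAWScalingLimit.Theses.SAWDevelopingMap
import Literature.Probability.RandomPlanarGeometry.HexParafermionTransport
import Literature.Probability.RandomPlanarGeometry.HexDomainSingleton

/-!
# `NoFoldBound` (route SAWDevelopingMap, item stmt-CriticalPhenomena-8296): the constant is at least `β_T/α_T`

Negative-side (cdisprove) lemma for the crux `NoFoldBound` ("∃ k < 1 such that the Beltrami mode of
the DCS parafermionic observable at every vertex of every simply connected hexagonal domain is at
most `k` times the sum mode"). We evaluate the observable EXACTLY on the smallest domain, the single
vertex `Λ₁ = {V0}` with source `a = {U0, V0}`: the only walks are the trivial one (`F(a) = 1`,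
`hexParafermionicObservable_self`) and the two one-step walks to the other two mid-edges, of
weights `x_c e^{± 5πi/24}` (turn `∓π/3`, `σ = 5/8`). Hence the triple at `V0` is the bare SOURCE
TRIPLE: sum mode `α_T = 1 + 2 x_c cos(5π/24) = 1.85872…`, DCS mode `0` (Lemma 1), Beltrami mode
`β_T = 1 + 2 x_c cos(11π/24) = 1.14128…`, so every admissible constant satisfies

  `β_T ≤ k · α_T`, i.e. `k ≥ β_T/α_T = 0.614014…` (**`noFoldBound_const_ge`**), in particular
  `k > 1/2` (**`noFoldBound_const_gt_half`**, using `2 x_c cos(π/8) = 1` and `cos(5π/24) < cos(π/8)`).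

So `NoFoldBound` cannot hold with any constant below the "corridor value" `β_T/α_T`; numerically the
supremum of the ratio over simply connected domains is ≈ 0.72–0.78 (effective sources with loops,
source law `(β_T + √3 L)/(α_T − √3 L)`, `L = x_c Z`, rooted-loop sum `Z_∞ ≈ 0.18 < sin(π/8)`), see the
crux's Disproof notes; no fold (ratio ≥ 1) exists among the 9.3·10⁸ exhaustively checked cases
(all simply connected vertex-domains with ≤ 16 vertices, all sources, all vertices).

Contents: coordinates of the witness (`V0 = (0,0)`, `U0 = (0,1)`, `N1 = (-e₀,1)`, `N2 = (-e₁,1)` as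
faces of `𝕋`), the classification of the walks of `Λ₁` (`verts = [V0]`), the two windings `∓π/3`
(computed through `ζ = e^{iπ/3}`: the turning quotients are `1 - ζ = e^{-iπ/3}` and `ζ`), the values
of `F`, the two mode identities, and the two bounds. Simple connectivity of `Λ₁` is
`hexDomainSimplyConnected_singleton` (`HexDomainSingleton.lean`).
-/

open Literature.Probability.LatticeModels Literature.Probability.RandomPlanarGeometry.SAW
open Literature.Probability.RandomPlanarGeometry.SAW.HV (omg omg_sq omg_add_one_ne_zero triZeta_eq_omg
  two_mul_xc_mul_cos)

namespace Summit.CriticalPhenomena.SAWScalingLimit.Theorems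


/-- `V0 ~ U0`. [folklore] -/
theorem nfb_adj_V0_U0 : hexGraph.Adj (((0 : Site 2)), (0 : Fin 2)) (((0 : Site 2)), (1 : Fin 2)) := by rw [hexGraph_adj_iff_coord]; simp
/-- `V0 ~ N1`. [folklore] -/
theorem nfb_adj_V0_N1 : hexGraph.Adj (((0 : Site 2)), (0 : Fin 2)) ((-(Pi.single 0 1 : Site 2)), (1 : Fin 2)) := by rw [hexGraph_adj_iff_coord]; simp
/-- `V0 ~ N2`. [folklore] -/
theorem nfb_adj_V0_N2 : hexGraph.Adj (((0 : Site 2)), (0 : Fin 2)) ((-(Pi.single 1 1 : Site 2)), (1 : Fin 2)) := by rw [hexGraph_adj_iff_coord]; simp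
/-- `U0 ≠ N1`. [folklore] -/
theorem nfb_U0_ne_N1 : (((0 : Site 2)), (1 : Fin 2)) ≠ ((-(Pi.single 0 1 : Site 2)), (1 : Fin 2)) := by
  intro h; have := congrArg (fun v : HexVertex => v.1 0) h; simp at this
/-- `U0 ≠ N2`. [folklore] -/
theorem nfb_U0_ne_N2 : (((0 : Site 2)), (1 : Fin 2)) ≠ ((-(Pi.single 1 1 : Site 2)), (1 : Fin 2)) := by
  intro h; have := congrArg (fun v : HexVertex => v.1 1) h; simp at this
/-- `N2 ≠ N1`. [folklore] -/
theorem nfb_N2_ne_N1 : ((-(Pi.single 1 1 : Site 2)), (1 : Fin 2)) ≠ ((-(Pi.single 0 1 : Site 2)), (1 : Fin 2)) := by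
  intro h; have := congrArg (fun v : HexVertex => v.1 0) h; simp at this
/-- `U0 ≠ V0`. [folklore] -/
theorem nfb_U0_ne_V0 : (((0 : Site 2)), (1 : Fin 2)) ≠ (((0 : Site 2)), (0 : Fin 2)) := by
  intro h; have := congrArg (fun v : HexVertex => v.2) h; simp at this

/-- `c(V0) = (1 + ζ)/3`. [folklore] -/
theorem nfb_hexCenter_V0 : hexCenter (((0 : Site 2)), (0 : Fin 2)) = (1 + triZeta) / 3 := by
  rw [hexCenter, triEmbed_zero]; norm_num
/-- `c(U0) = 2(1 + ζ)/3`. [folklore] -/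
theorem nfb_hexCenter_U0 : hexCenter (((0 : Site 2)), (1 : Fin 2)) = 2 * (1 + triZeta) / 3 := by
  rw [hexCenter, triEmbed_zero]; norm_num
/-- `c(N1) = -1 + 2(1 + ζ)/3`. [folklore] -/
theorem nfb_hexCenter_N1 : hexCenter ((-(Pi.single 0 1 : Site 2)), (1 : Fin 2)) = -1 + 2 * (1 + triZeta) / 3 := by
  rw [hexCenter, triEmbed]; norm_num
/-- `c(N2) = -ζ + 2(1 + ζ)/3`. [folklore] -/
theorem nfb_hexCenter_N2 : hexCenter ((-(Pi.single 1 1 : Site 2)), (1 : Fin 2)) = -triZeta + 2 * (1 + triZeta) / 3 := by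
  rw [hexCenter, triEmbed]; norm_num

/-- The source `a = {U0, V0}` is a boundary mid-edge of `{V0}`. [folklore] -/
theorem nfb_src_mem_boundary : s((((0 : Site 2)), (1 : Fin 2)), (((0 : Site 2)), (0 : Fin 2))) ∈ hexDomainBoundary ({(((0 : Site 2)), (0 : Fin 2))} : Finset HexVertex) := by
  refine ⟨?_, (((0 : Site 2)), (1 : Fin 2)), (((0 : Site 2)), (0 : Fin 2)), rfl, by simp, by simp⟩
  exact (SimpleGraph.mem_edgeSet hexGraph).2 nfb_adj_V0_U0.symm

/-- Every walk of `{V0}` from `a` to another mid-edge of `V0` is the one-step walk. [folklore] -/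
theorem nfb_verts_eq {n : HexVertex} (hz : s((((0 : Site 2)), (0 : Fin 2)), n) ≠ s((((0 : Site 2)), (1 : Fin 2)), (((0 : Site 2)), (0 : Fin 2))))
    (γ : HexMidEdgeSAW ({(((0 : Site 2)), (0 : Fin 2))} : Finset HexVertex) s((((0 : Site 2)), (1 : Fin 2)), (((0 : Site 2)), (0 : Fin 2))) s((((0 : Site 2)), (0 : Fin 2)), n)) : γ.verts = [(((0 : Site 2)), (0 : Fin 2))] := by
  have hsub : ∀ v ∈ γ.verts, v = (((0 : Site 2)), (0 : Fin 2)) := fun v hv => by simpa using γ.subset v hv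
  have hnd := γ.nodup
  rcases h : γ.verts with _ | ⟨v, l⟩
  · exact absurd (γ.eq_of_nil h) hz.symm
  · have hv : v = (((0 : Site 2)), (0 : Fin 2)) := hsub v (by simp [h])
    rcases l with _ | ⟨w, l'⟩
    · rw [hv]
    · have hw : w = (((0 : Site 2)), (0 : Fin 2)) := hsub w (by simp [h])
      rw [h, hv, hw] at hnd
      simp at hnd

/-- The observable of `{V0}` at a mid-edge `{V0, n}`, `n ≠ U0`: the weight of the one-step walk,
`e^{-iσW} x` with `W` the turning `mid(a) → c(V0) → mid{V0,n}`. [folklore] -/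
theorem nfb_observable_step (n : HexVertex) (hnu : n ≠ (((0 : Site 2)), (1 : Fin 2))) (x σ : ℝ) :
    hexParafermionicObservable ({(((0 : Site 2)), (0 : Fin 2))} : Finset HexVertex) s((((0 : Site 2)), (1 : Fin 2)), (((0 : Site 2)), (0 : Fin 2))) x σ s((((0 : Site 2)), (0 : Fin 2)), n) =
      Complex.exp (-Complex.I * σ *
        (turning (hexMidpoint s((((0 : Site 2)), (1 : Fin 2)), (((0 : Site 2)), (0 : Fin 2)))) (hexCenter (((0 : Site 2)), (0 : Fin 2))) (hexMidpoint s((((0 : Site 2)), (0 : Fin 2)), n)) : ℝ)) * x := by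
  have hne : s((((0 : Site 2)), (1 : Fin 2)), (((0 : Site 2)), (0 : Fin 2))) ≠ s((((0 : Site 2)), (0 : Fin 2)), n) := by
    rw [Ne, Sym2.eq_iff]
    rintro (⟨h1, -⟩ | ⟨h1, -⟩)
    · exact nfb_U0_ne_V0 h1
    · exact hnu h1.symm
  let γ₀ : HexMidEdgeSAW ({(((0 : Site 2)), (0 : Fin 2))} : Finset HexVertex) s((((0 : Site 2)), (1 : Fin 2)), (((0 : Site 2)), (0 : Fin 2))) s((((0 : Site 2)), (0 : Fin 2)), n) :=
    { verts := [(((0 : Site 2)), (0 : Fin 2))]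
      subset := by simp
      nodup := List.nodup_singleton _
      isChain := List.IsChain.singleton _
      head_mem := by simp
      getLast_mem := by simp
      eq_of_nil := by simp
      edges_nodup := fun _ => by simp [hne]
      fst_mem := hexDomainBoundary_subset _ nfb_src_mem_boundary }
  letI : Unique (HexMidEdgeSAW ({(((0 : Site 2)), (0 : Fin 2))} : Finset HexVertex) s((((0 : Site 2)), (1 : Fin 2)), (((0 : Site 2)), (0 : Fin 2))) s((((0 : Site 2)), (0 : Fin 2)), n)) :=
    ⟨⟨γ₀⟩, fun γ => HexMidEdgeSAW.ext (by rw [nfb_verts_eq hne.symm γ]; rfl)⟩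
  rw [hexParafermionicObservable, Fintype.sum_unique]
  show γ₀.weight x σ = _
  simp [HexMidEdgeSAW.weight, HexMidEdgeSAW.winding, HexMidEdgeSAW.points, HexMidEdgeSAW.length, γ₀]

/-- `c(V0) - mid(a) ≠ 0`. [folklore] -/
theorem nfb_sub_src_ne_zero : hexCenter (((0 : Site 2)), (0 : Fin 2)) - hexMidpoint s((((0 : Site 2)), (1 : Fin 2)), (((0 : Site 2)), (0 : Fin 2))) ≠ 0 := by
  rw [hexMidpoint_mk, nfb_hexCenter_V0, nfb_hexCenter_U0, triZeta_eq_omg]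
  intro h
  apply omg_add_one_ne_zero
  linear_combination (-6 : ℂ) * h

/-- The turning quotient towards `N1` is `1 - ζ = e^{-iπ/3}`. [folklore] -/
theorem nfb_ratio_N1 : (hexMidpoint s((((0 : Site 2)), (0 : Fin 2)), ((-(Pi.single 0 1 : Site 2)), (1 : Fin 2))) - hexCenter (((0 : Site 2)), (0 : Fin 2))) / (hexCenter (((0 : Site 2)), (0 : Fin 2)) - hexMidpoint s((((0 : Site 2)), (1 : Fin 2)), (((0 : Site 2)), (0 : Fin 2)))) =
    1 - omg := by
  rw [div_eq_iff nfb_sub_src_ne_zero, hexMidpoint_mk, hexMidpoint_mk, nfb_hexCenter_V0,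
    nfb_hexCenter_U0, nfb_hexCenter_N1, triZeta_eq_omg]
  linear_combination (-1 / 6 : ℂ) * omg_sq

/-- The turning quotient towards `N2` is `ζ = e^{iπ/3}`. [folklore] -/
theorem nfb_ratio_N2 : (hexMidpoint s((((0 : Site 2)), (0 : Fin 2)), ((-(Pi.single 1 1 : Site 2)), (1 : Fin 2))) - hexCenter (((0 : Site 2)), (0 : Fin 2))) / (hexCenter (((0 : Site 2)), (0 : Fin 2)) - hexMidpoint s((((0 : Site 2)), (1 : Fin 2)), (((0 : Site 2)), (0 : Fin 2)))) =
    omg := by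
  rw [div_eq_iff nfb_sub_src_ne_zero, hexMidpoint_mk, hexMidpoint_mk, nfb_hexCenter_V0,
    nfb_hexCenter_U0, nfb_hexCenter_N2, triZeta_eq_omg]
  linear_combination (1 / 6 : ℂ) * omg_sq

/-- `1 - ζ = e^{-iπ/3}`. [folklore] -/
theorem nfb_one_sub_omg : 1 - omg = Complex.exp (((-(Real.pi / 3) : ℝ) : ℂ) * Complex.I) := by
  have h := Complex.two_cos ((Real.pi / 3 : ℝ) : ℂ)
  rw [← Complex.ofReal_cos, Real.cos_pi_div_three] at h
  rw [omg]
  push_cast at h ⊢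
  linear_combination h

/-- The turn towards `N1` is `-π/3`. [folklore] -/
theorem nfb_turning_N1 : turning (hexMidpoint s((((0 : Site 2)), (1 : Fin 2)), (((0 : Site 2)), (0 : Fin 2)))) (hexCenter (((0 : Site 2)), (0 : Fin 2))) (hexMidpoint s((((0 : Site 2)), (0 : Fin 2)), ((-(Pi.single 0 1 : Site 2)), (1 : Fin 2)))) =
    -(Real.pi / 3) := by
  rw [turning, nfb_ratio_N1, nfb_one_sub_omg, Complex.exp_mul_I,
    Complex.arg_cos_add_sin_mul_I ⟨by linarith [Real.pi_pos], by linarith [Real.pi_pos]⟩]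

/-- The turn towards `N2` is `+π/3`. [folklore] -/
theorem nfb_turning_N2 : turning (hexMidpoint s((((0 : Site 2)), (1 : Fin 2)), (((0 : Site 2)), (0 : Fin 2)))) (hexCenter (((0 : Site 2)), (0 : Fin 2))) (hexMidpoint s((((0 : Site 2)), (0 : Fin 2)), ((-(Pi.single 1 1 : Site 2)), (1 : Fin 2)))) =
    Real.pi / 3 := by
  rw [turning, nfb_ratio_N2, omg, Complex.exp_mul_I,
    Complex.arg_cos_add_sin_mul_I ⟨by linarith [Real.pi_pos], by linarith [Real.pi_pos]⟩]


/-- `F(a) = 1`. [folklore] -/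
theorem nfb_F_src : hexParafermionicObservable ({(((0 : Site 2)), (0 : Fin 2))} : Finset HexVertex) s((((0 : Site 2)), (1 : Fin 2)), (((0 : Site 2)), (0 : Fin 2))) hexCriticalFugacity (5 / 8) s((((0 : Site 2)), (0 : Fin 2)), (((0 : Site 2)), (1 : Fin 2))) = 1 := by
  rw [show s((((0 : Site 2)), (0 : Fin 2)), (((0 : Site 2)), (1 : Fin 2))) = s((((0 : Site 2)), (1 : Fin 2)), (((0 : Site 2)), (0 : Fin 2))) from Sym2.eq_swap]
  exact hexParafermionicObservable_self nfb_src_mem_boundary _ _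

/-- `F{V0, N1} = x_c e^{5πi/24}`. [folklore] -/
theorem nfb_F_N1 : hexParafermionicObservable ({(((0 : Site 2)), (0 : Fin 2))} : Finset HexVertex) s((((0 : Site 2)), (1 : Fin 2)), (((0 : Site 2)), (0 : Fin 2))) hexCriticalFugacity (5 / 8) s((((0 : Site 2)), (0 : Fin 2)), ((-(Pi.single 0 1 : Site 2)), (1 : Fin 2))) =
    (hexCriticalFugacity : ℂ) * Complex.exp (((5 * Real.pi / 24 : ℝ) : ℂ) * Complex.I) := by
  rw [nfb_observable_step ((-(Pi.single 0 1 : Site 2)), (1 : Fin 2)) nfb_U0_ne_N1.symm, nfb_turning_N1, mul_comm]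
  congr 1; push_cast; ring_nf

/-- `F{V0, N2} = x_c e^{-5πi/24}`. [folklore] -/
theorem nfb_F_N2 : hexParafermionicObservable ({(((0 : Site 2)), (0 : Fin 2))} : Finset HexVertex) s((((0 : Site 2)), (1 : Fin 2)), (((0 : Site 2)), (0 : Fin 2))) hexCriticalFugacity (5 / 8) s((((0 : Site 2)), (0 : Fin 2)), ((-(Pi.single 1 1 : Site 2)), (1 : Fin 2))) =
    (hexCriticalFugacity : ℂ) * Complex.exp (-((5 * Real.pi / 24 : ℝ) : ℂ) * Complex.I) := by
  rw [nfb_observable_step ((-(Pi.single 1 1 : Site 2)), (1 : Fin 2)) nfb_U0_ne_N2.symm, nfb_turning_N2, mul_comm]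
  congr 1; push_cast; ring_nf

/-- **The sum mode of the witness triple is `α_T = 1 + 2 x_c cos(5π/24)`.** [folklore] -/
theorem nfb_triple_sum : hexParafermionicObservable ({(((0 : Site 2)), (0 : Fin 2))} : Finset HexVertex) s((((0 : Site 2)), (1 : Fin 2)), (((0 : Site 2)), (0 : Fin 2))) hexCriticalFugacity (5 / 8) s((((0 : Site 2)), (0 : Fin 2)), (((0 : Site 2)), (1 : Fin 2))) + hexParafermionicObservable ({(((0 : Site 2)), (0 : Fin 2))} : Finset HexVertex) s((((0 : Site 2)), (1 : Fin 2)), (((0 : Site 2)), (0 : Fin 2))) hexCriticalFugacity (5 / 8) s((((0 : Site 2)), (0 : Fin 2)), ((-(Pi.single 1 1 : Site 2)), (1 : Fin 2))) + hexParafermionicObservable ({(((0 : Site 2)), (0 : Fin 2))} : Finset HexVertex) s((((0 : Site 2)), (1 : Fin 2)), (((0 : Site 2)), (0 : Fin 2))) hexCriticalFugacity (5 / 8) s((((0 : Site 2)), (0 : Fin 2)), ((-(Pi.single 0 1 : Site 2)), (1 : Fin 2))) =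
    ((1 + 2 * hexCriticalFugacity * Real.cos (5 * Real.pi / 24) : ℝ) : ℂ) := by
  rw [nfb_F_src, nfb_F_N1, nfb_F_N2]
  have h := Complex.two_cos ((5 * Real.pi / 24 : ℝ) : ℂ)
  push_cast at h ⊢
  linear_combination (-(hexCriticalFugacity : ℂ)) * h

/-- **The Beltrami mode of the witness triple (labelling `U0, N2, N1`) is
`β_T = 1 + 2 x_c cos(11π/24)`.** [folklore] -/
theorem nfb_triple_beltrami :
    hexParafermionicObservable ({(((0 : Site 2)), (0 : Fin 2))} : Finset HexVertex) s((((0 : Site 2)), (1 : Fin 2)), (((0 : Site 2)), (0 : Fin 2))) hexCriticalFugacity (5 / 8) s((((0 : Site 2)), (0 : Fin 2)), (((0 : Site 2)), (1 : Fin 2))) + Complex.exp (2 * Real.pi * Complex.I / 3) * hexParafermionicObservable ({(((0 : Site 2)), (0 : Fin 2))} : Finset HexVertex) s((((0 : Site 2)), (1 : Fin 2)), (((0 : Site 2)), (0 : Fin 2))) hexCriticalFugacity (5 / 8) s((((0 : Site 2)), (0 : Fin 2)), ((-(Pi.single 1 1 : Site 2)), (1 : Fin 2))) +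
      Complex.exp (2 * Real.pi * Complex.I / 3) ^ 2 * hexParafermionicObservable ({(((0 : Site 2)), (0 : Fin 2))} : Finset HexVertex) s((((0 : Site 2)), (1 : Fin 2)), (((0 : Site 2)), (0 : Fin 2))) hexCriticalFugacity (5 / 8) s((((0 : Site 2)), (0 : Fin 2)), ((-(Pi.single 0 1 : Site 2)), (1 : Fin 2))) =
    ((1 + 2 * hexCriticalFugacity * Real.cos (11 * Real.pi / 24) : ℝ) : ℂ) := by
  rw [nfb_F_src, nfb_F_N1, nfb_F_N2]
  have h := Complex.two_cos ((11 * Real.pi / 24 : ℝ) : ℂ)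
  have e1 : Complex.exp (2 * Real.pi * Complex.I / 3) *
      Complex.exp (-((5 * Real.pi / 24 : ℝ) : ℂ) * Complex.I) =
      Complex.exp (((11 * Real.pi / 24 : ℝ) : ℂ) * Complex.I) := by
    rw [← Complex.exp_add]; congr 1; push_cast; ring
  have e2 : Complex.exp (2 * Real.pi * Complex.I / 3) ^ 2 *
      Complex.exp (((5 * Real.pi / 24 : ℝ) : ℂ) * Complex.I) =
      Complex.exp (-((11 * Real.pi / 24 : ℝ) : ℂ) * Complex.I) := by
    rw [sq, ← Complex.exp_add, ← Complex.exp_add]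
    rw [show 2 * (Real.pi : ℂ) * Complex.I / 3 + 2 * Real.pi * Complex.I / 3 +
          ((5 * Real.pi / 24 : ℝ) : ℂ) * Complex.I =
        -((11 * Real.pi / 24 : ℝ) : ℂ) * Complex.I + 2 * Real.pi * Complex.I by push_cast; ring,
      Complex.exp_add, Complex.exp_two_pi_mul_I, mul_one]
  push_cast at h e1 e2 ⊢
  linear_combination (-(hexCriticalFugacity : ℂ)) * h +
    (hexCriticalFugacity : ℂ) * e1 + (hexCriticalFugacity : ℂ) * e2

/-- `x_c > 0`. [folklore] -/
theorem nfb_xc_pos : 0 < hexCriticalFugacity := by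
  rw [hexCriticalFugacity]; positivity

/-- `α_T > 0`. [folklore] -/
theorem nfb_alphaT_pos : 0 < 1 + 2 * hexCriticalFugacity * Real.cos (5 * Real.pi / 24) := by
  have hc : 0 ≤ Real.cos (5 * Real.pi / 24) := Real.cos_nonneg_of_mem_Icc
    ⟨by linarith [Real.pi_pos], by linarith [Real.pi_pos]⟩
  have := nfb_xc_pos
  positivity

/-- `β_T ≥ 0`. [folklore] -/
theorem nfb_betaT_nonneg : 0 ≤ 1 + 2 * hexCriticalFugacity * Real.cos (11 * Real.pi / 24) := by
  have hc : 0 ≤ Real.cos (11 * Real.pi / 24) := Real.cos_nonneg_of_mem_Icc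
    ⟨by linarith [Real.pi_pos], by linarith [Real.pi_pos]⟩
  have := nfb_xc_pos
  positivity

/-- `α_T < 2 β_T` (indeed `α_T < 2 ≤ 2β_T`, from `2 x_c cos(π/8) = 1` and `cos(5π/24) < cos(π/8)`).
[folklore] -/
theorem nfb_alphaT_lt_two_betaT : 1 + 2 * hexCriticalFugacity * Real.cos (5 * Real.pi / 24) <
    2 * (1 + 2 * hexCriticalFugacity * Real.cos (11 * Real.pi / 24)) := by
  have hc : 0 ≤ Real.cos (11 * Real.pi / 24) := Real.cos_nonneg_of_mem_Icc
    ⟨by linarith [Real.pi_pos], by linarith [Real.pi_pos]⟩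
  have hx := nfb_xc_pos
  have hlt : Real.cos (5 * Real.pi / 24) < Real.cos (Real.pi / 8) :=
    Real.cos_lt_cos_of_nonneg_of_le_pi_div_two (by linarith [Real.pi_pos])
      (by linarith [Real.pi_pos]) (by linarith [Real.pi_pos])
  have h1 := two_mul_xc_mul_cos
  nlinarith

/-- **`NoFoldBound` cannot hold with a constant below `β_T/α_T`** (cdisprove tightness lemma for
crux stmt-CriticalPhenomena-8296): if `k` satisfies the body of
`Summit.CriticalPhenomena.SAWScalingLimit.Theses.SAWDevelopingMap.NoFoldBound`, then
`(1 + 2 x_c cos(11π/24)) / (1 + 2 x_c cos(5π/24)) ≤ k`, i.e. `k ≥ 0.614014…`; witnessed by the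
one-vertex domain `{V0}`, source `{U0, V0}`, labelling `(U0, N2, N1)`. [folklore] -/
theorem noFoldBound_const_ge {k : ℝ}
    (h : ∀ (Λ : Finset HexVertex), hexDomainSimplyConnected Λ → ∀ a ∈ hexDomainBoundary Λ, ∀ v ∈ Λ,
      ∀ w₀ w₁ w₂ : HexVertex, hexGraph.Adj v w₀ → hexGraph.Adj v w₁ → hexGraph.Adj v w₂ →
      w₀ ≠ w₁ → w₁ ≠ w₂ → w₀ ≠ w₂ →
      let F : Sym2 HexVertex → ℂ := hexParafermionicObservable Λ a hexCriticalFugacity (5 / 8)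
      let ω : ℂ := Complex.exp (2 * Real.pi * Complex.I / 3)
      ‖F s(v, w₀) + ω * F s(v, w₁) + ω ^ 2 * F s(v, w₂)‖ ≤
        k * ‖F s(v, w₀) + F s(v, w₁) + F s(v, w₂)‖) :
    (1 + 2 * hexCriticalFugacity * Real.cos (11 * Real.pi / 24)) /
      (1 + 2 * hexCriticalFugacity * Real.cos (5 * Real.pi / 24)) ≤ k := by
  have h1 := h {(((0 : Site 2)), (0 : Fin 2))} (hexDomainSimplyConnected_singleton _) s((((0 : Site 2)), (1 : Fin 2)), (((0 : Site 2)), (0 : Fin 2))) nfb_src_mem_boundary (((0 : Site 2)), (0 : Fin 2)) (by simp)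
    (((0 : Site 2)), (1 : Fin 2)) ((-(Pi.single 1 1 : Site 2)), (1 : Fin 2)) ((-(Pi.single 0 1 : Site 2)), (1 : Fin 2)) nfb_adj_V0_U0 nfb_adj_V0_N2 nfb_adj_V0_N1 nfb_U0_ne_N2 nfb_N2_ne_N1 nfb_U0_ne_N1
  dsimp only at h1
  rw [nfb_triple_beltrami, nfb_triple_sum, Complex.norm_real, Complex.norm_real,
    Real.norm_of_nonneg nfb_betaT_nonneg, Real.norm_of_nonneg nfb_alphaT_pos.le] at h1
  exact (div_le_iff₀ nfb_alphaT_pos).2 h1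

/-- **Corollary: the constant of `NoFoldBound` exceeds `1/2`.** [folklore] -/
theorem noFoldBound_const_gt_half {k : ℝ}
    (h : ∀ (Λ : Finset HexVertex), hexDomainSimplyConnected Λ → ∀ a ∈ hexDomainBoundary Λ, ∀ v ∈ Λ,
      ∀ w₀ w₁ w₂ : HexVertex, hexGraph.Adj v w₀ → hexGraph.Adj v w₁ → hexGraph.Adj v w₂ →
      w₀ ≠ w₁ → w₁ ≠ w₂ → w₀ ≠ w₂ →
      let F : Sym2 HexVertex → ℂ := hexParafermionicObservable Λ a hexCriticalFugacity (5 / 8)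
      let ω : ℂ := Complex.exp (2 * Real.pi * Complex.I / 3)
      ‖F s(v, w₀) + ω * F s(v, w₁) + ω ^ 2 * F s(v, w₂)‖ ≤
        k * ‖F s(v, w₀) + F s(v, w₁) + F s(v, w₂)‖) :
    1 / 2 < k := by
  have h1 := noFoldBound_const_ge h
  have h2 : 1 / 2 < (1 + 2 * hexCriticalFugacity * Real.cos (11 * Real.pi / 24)) /
      (1 + 2 * hexCriticalFugacity * Real.cos (5 * Real.pi / 24)) := by
    rw [lt_div_iff₀ nfb_alphaT_pos]
    linarith [nfb_alphaT_lt_two_betaT]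
  exact h2.trans_le h1

/-- The same, keyed to the crux: `NoFoldBound` yields a constant `k ∈ [β_T/α_T, 1)`. [folklore] -/
theorem noFoldBound_const_window
    (h : Summit.CriticalPhenomena.SAWScalingLimit.Theses.SAWDevelopingMap.NoFoldBound) :
    ∃ k : ℝ, (1 + 2 * hexCriticalFugacity * Real.cos (11 * Real.pi / 24)) /
      (1 + 2 * hexCriticalFugacity * Real.cos (5 * Real.pi / 24)) ≤ k ∧ k < 1 := by
  obtain ⟨k, hk, hb⟩ := h
  exact ⟨k, noFoldBound_const_ge hb, hk⟩

end Summit.CriticalPhenomena.SAWScalingLimit.Theorems
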